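import Literature.AlgebraicGeometry.Frobenioids.ModelFrobenioidComparisonFunctor
import Literature.AlgebraicGeometry.Frobenioids.ModelFrobenioidComparison
import Mathlib.CategoryTheory.Whiskering
import HarnessLib

/-!
# Frobenioids I, Theorem 5.2 (iv): assembly — the theorem follows from the unit entry and the
equivalence of the comparison functor

Mochizuki, *The geometry of Frobenioids I: the general theory*, Kyushu J. Math. **62** (2008)
293–400, §5, proof of Theorem 5.2 (iv), kurims text pp. 101–103 [cite: MochizukiFrdI2008, Thm.
5.2(iv) p.101]:
"Thus, we have a natural functor `C′ → C` … which is manifestly an equivalence of categories. Thus,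
it suffices to construct an equivalence of categories `C′ ⥲` [model] that is compatible with the
functors
`C′ → C → F_Φ`, [model] `→ F_Φ`."

The reduction step of the printed proof, kernel-checked: `Thm52iv` (v3 statement,
`ModelFrobenioidComparison.lean`) follows as soon as, under its hypotheses, one has a class `P` of
objects such that every object admits an `F_P`-path (for the base-section of a base-Frobenius pair:
`nonempty_fpPath`), a unit datum `U : UnitData` (the fourth entry, Remark 2.7.2) and the comparison
functor `comparison U : C′ → model` is an equivalence: then `E := (C′ → C)⁻¹ ⋙ comparison U` is an
equivalence `C ⥲ model`, 1-commuting with the functors to `F_Φ` by `comparisonToElemIso`.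
-/

namespace Literature.AlgebraicGeometry.Frobenioids

open CategoryTheory Opposite

universe w v v' u u'

namespace PreFrobenioid

variable {D : Type u} [Category.{v} D] {Φ : Dᵒᵖ ⥤ CommMonCat.{w}}
  {C : Type u'} [Category.{v'} C] {F : C ⥤ ElemFrobenioid Φ}

/-- The equivalence `C ⥲ model` assembled from an inverse of `C′ → C` and the comparison functor,
with its
1-commutativity. [cite: MochizukiFrdI2008, Thm. 5.2(iv) p.102] -/
theorem exists_equivalence_of_comparison {hF : IsFrobenioid F} {hsq : HasBiratSquares F} {P : Set C}
    (hP : ∀ X : C, Nonempty (FPPath F P X)) {B : Dᵒᵖ ⥤ CommMonCat.{w}} {DivB : B ⟶ monoidGp Φ}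
    (U : UnitData hF hsq P B DivB) (hU : (UnitData.comparison U).IsEquivalence) :
    ∃ E : C ⥤ ModelFrobenioid Φ B DivB, E.IsEquivalence ∧
      OneCommutes E (ModelFrobenioid.toElem Φ B DivB) F (𝟭 (ElemFrobenioid Φ)) := by
  haveI := PathCat.forget_isEquivalence hP
  haveI := hU
  refine ⟨(PathCat.forget F P).inv ⋙ UnitData.comparison U, inferInstance, ⟨?_⟩⟩
  exact Functor.associator _ _ _ ≪≫ Functor.isoWhiskerLeft _ (UnitData.comparisonToElemIso U) ≪≫
    (Functor.associator _ _ _).symm ≪≫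
    Functor.isoWhiskerRight (PathCat.forget F P).asEquivalence.counitIso F ≪≫ F.leftUnitor ≪≫
    F.rightUnitor.symm

variable (F) in
/-- **Theorem 5.2 (iv), reduction**: the statement `Thm52iv` follows from the construction, under
its
hypotheses, of (a) a class `P` with `F_P`-paths for all objects, (b) the unit datum and (c) the
equivalence property of the comparison functor. [cite: MochizukiFrdI2008, Thm. 5.2(iv) p.102] -/
theorem thm52iv_of_comparison (hF : IsFrobenioid F) (hsq : HasBiratSquares F)
    (h : IsOfModelType F hF hsq → IsOfIsotropicType F →
      ∀ (B : Dᵒᵖ ⥤ CommMonCat.{w}) (DivB : B ⟶ monoidGp Φ)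
        (_ : RationalFunctionMonoidStr F hF B DivB),
        ∃ (P : Set C) (_ : ∀ X : C, Nonempty (FPPath F P X)) (U : UnitData hF hsq P B DivB),
          (UnitData.comparison U).IsEquivalence) :
    Thm52iv F hF hsq := by
  rintro ⟨hmod, hiso⟩ B DivB R
  obtain ⟨P, hP, U, hU⟩ := h hmod hiso B DivB R
  exact exists_equivalence_of_comparison hP U hU

/-- The class `P` is supplied by model type: the objects of the base-section of a base-Frobenius
pair
(`IsOfPreModelType`), every object admitting an `F_P`-path by isotropy (`nonempty_fpPath`).  So
`Thm52iv` reduces to the unit datum and the equivalence property for THAT `P`.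
[cite: MochizukiFrdI2008, Thm. 5.2(iv) p.101] -/
theorem thm52iv_of_comparison' (hF : IsFrobenioid F) (hsq : HasBiratSquares F)
    (h : IsOfModelType F hF hsq → IsOfIsotropicType F →
      ∀ (P : Presection C) (Fr : ℕ+ →* CategoryTheory.End P.ι), IsBaseFrobeniusPair F P Fr →
      ∀ (B : Dᵒᵖ ⥤ CommMonCat.{w}) (DivB : B ⟶ monoidGp Φ)
        (_ : RationalFunctionMonoidStr F hF B DivB),
        ∃ U : UnitData hF hsq {A | P.obj A} B DivB, (UnitData.comparison U).IsEquivalence) :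
    Thm52iv F hF hsq := by
  apply thm52iv_of_comparison
  intro hmod hiso B DivB R
  obtain ⟨P, Fr, hPF⟩ := hmod.1
  obtain ⟨U, hU⟩ := h hmod hiso P Fr hPF B DivB R
  exact ⟨{A | P.obj A}, nonempty_fpPath hF hiso hPF.isBaseSection, U, hU⟩

end PreFrobenioid

end Literature.AlgebraicGeometry.Frobenioids
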